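import Summits.CriticalPhenomena.PercolationContinuityZ3.Theorems.PercNearOneGluingNoHeavyQuantLawDecStrongDuality
import Summits.CriticalPhenomena.PercolationContinuityZ3.Theorems.PercNearOneGluingNoHeavyQuantLawDecUsageMonge
import HarnessLib

/-!
# QUANT lane R8, T-DEC: THE SINGLE-MID CRITERION — a law whose lows are routed into ONE mid and the giant pool is DEC as soon as the
# fractional-knapsack inequalities hold (`LawDec.decAtT_of_singleMid`; census-2 g59, for the pooled residue of `LightSliceCore`)

builds on p205010 (kernel theorem, internal audit signed; external expert review pending)

Support file (`--supports stmt-CriticalPhenomena-4575`), QUANT lane seat prim-quant-census-2 (gen 59), rung R8 of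
`run/shared/lean/prim/quant/LADDER.md`.  Memo `run/shared/lean/prim/quant/prim-quant-census-2-g59/ASSEMBLY-G59.md` §3.  Theorems only,
standard axioms, no sorries, no definitions.

WHY.  The pooled residue of the light-slice core (`LawDec.LightSliceLowCross`, census-1's pattern LLG; and the crossed Type II class with the lower
cross cell a giant) is a law with FOUR conv-lows, ONE useful mid (the head cell `p + h` of the light row) and giants.  For such a law the flow LP of
`LawDec.FlowAtT` is a fractional knapsack: ship low mass into the mid at the rates `usage(l, h)` as long as it pays, the rest rides the giant pool at
rate `u = x/(1−x)`.  By LP duality (census-2 g54's `LawDec.decAtT_iff_prices`) feasibility is equivalent to a ONE-PARAMETER family of linear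
inequalities — the knapsack dual — which this file puts in the kernel as a SUFFICIENT criterion (the form a cell proof needs):

* **`LawDec.decAtT_of_singleMid`** — floor `0 < x < 1`, target `T`, layer `j`, top `M`, a law `μ ≥ 0` on `{0..M}` of mass one, a MID `h`
  (`h ≤ j`, `h ≤ M`, `T ≤ 2h`).  Write `G = Σ_{j < k ≤ M} μ k` (giant mass), call a low `l` (`l ≤ j`, `2l < T`) COMPATIBLE if `T < l + h`, and let
  `L_inc` be the mass of the incompatible lows.  If `u·L_inc ≤ G` and, for every `θ ≥ 0`,
  `Σ_{l compatible} μ l · min(usage(l,h), θ) + θ·L_inc ≤ μ h + θ·G/u`, then `DECAtT x T j M μ`.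
  (Only the mid `h` and the giants are used as absorbers; other mids may carry mass and are simply not loaded.  The function of `θ` on the left is
  concave piecewise linear and the right side is affine, so in a cell proof — where the compatible lows and the ORDER of their usages are explicit —
  one splits on the position of `θ` among the usages; on each interval both sides are affine and the two endpoint inequalities, i.e. the knapsack
  BREAKPOINT inequalities `μ h + (usage(r,h)/u)·G ≥ Σ_l μ l·min(usage(l,h), usage(r,h)) + usage(r,h)·L_inc`, give it by `linarith`.)
* `LawDec.decAtT_of_singleMid_noInc` — the same without incompatible lows.
PROOF: in `decAtT_iff_prices` take prices `α` (lows), `β ≥ 0` (absorbers) with `α l ≤ usage·β` on valid pairs; with `A = max_l α l` and `y = β h`,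
every giant has `β ≥ A/u`, a compatible low has `α l ≤ min(y·usage, A) = y·min(usage, A/y)`, an incompatible one `α l ≤ A`; the hypothesis at
`θ = A/y` (or `u·L_inc ≤ G` when `y = 0`) is exactly the weak-duality inequality.

[this work]; LP duality [cite: Schrijver1986, Cor 7.1f (p. 90)] via `…QuantLawDecStrongDuality`.  The gluing rows served
[cite: KozmaNitzan2024, Conjecture 3 (p. 15)]; product measure [cite: Grimmett1999, §1.3 p. 10].
-/

noncomputable section

namespace Summit.CriticalPhenomena.PercolationContinuityZ3.Theorems

namespace Quant

open Finset

namespace LawDec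

/-- **THE SINGLE-MID CRITERION (knapsack dual, sufficient form).**  See the module docstring. [this work] -/
theorem decAtT_of_singleMid (x T : ℝ) (j M h : ℕ) (μ : ℕ → ℝ) (hx0 : 0 < x) (hx1 : x < 1)
    (hμ0 : ∀ k, 0 ≤ μ k) (hμM : ∀ k, M < k → μ k = 0) (hμ1 : ∑ k ∈ Finset.range (M + 1), μ k = 1)
    (hhj : h ≤ j) (hhM : h ≤ M) (hhT : T ≤ 2 * (h : ℝ))
    (hinc : x / (1 - x) * ∑ l ∈ Finset.range (j + 1), (if 2 * (l : ℝ) < T ∧ ¬ (T < (l : ℝ) + h) then μ l else 0)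
      ≤ ∑ k ∈ Finset.Ico (j + 1) (M + 1), μ k)
    (hknap : ∀ θ : ℝ, 0 ≤ θ →
      ∑ l ∈ Finset.range (j + 1),
          (if 2 * (l : ℝ) < T then (if T < (l : ℝ) + h then μ l * min (usage x T j l h) θ else θ * μ l) else 0)
        ≤ μ h + θ * ((1 - x) / x) * ∑ k ∈ Finset.Ico (j + 1) (M + 1), μ k) :
    DECAtT x T j M μ := by
  classical
  rw [decAtT_iff_prices x T j M μ hx0 hx1 hμM hμ1]
  intro α β hβ hαβ
  have h1x : 0 < 1 - x := by linarith
  have hu0 : 0 < x / (1 - x) := div_pos hx0 h1x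
  set G := ∑ k ∈ Finset.Ico (j + 1) (M + 1), μ k with hG
  have hG0 : 0 ≤ G := Finset.sum_nonneg fun k _ => hμ0 k
  -- the right-hand side dominates the mid term plus the giant terms
  have hRHS : β h * μ h + ∑ k ∈ Finset.Ico (j + 1) (M + 1), β k * μ k
      ≤ ∑ k ∈ Finset.range (M + 1), (if k ≤ j ∧ 2 * (k : ℝ) < T then 0 else β k * μ k) := by
    have hsub : insert h (Finset.Ico (j + 1) (M + 1)) ⊆ Finset.range (M + 1) := by
      intro k hk
      rw [Finset.mem_insert] at hk
      rw [Finset.mem_range]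
      rcases hk with rfl | hk
      · omega
      · rw [Finset.mem_Ico] at hk; omega
    have hnn : ∀ k ∈ Finset.range (M + 1), k ∉ insert h (Finset.Ico (j + 1) (M + 1)) →
        0 ≤ (if k ≤ j ∧ 2 * (k : ℝ) < T then 0 else β k * μ k) := by
      intro k _ _
      split_ifs
      · exact le_rfl
      · exact mul_nonneg (hβ k) (hμ0 k)
    refine le_trans (le_of_eq ?_) (Finset.sum_le_sum_of_subset_of_nonneg hsub hnn)
    rw [Finset.sum_insert (by rw [Finset.mem_Ico]; omega)]
    rw [if_neg (by push Not; intro _; linarith)]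
    congr 1
    refine Finset.sum_congr rfl fun k hk => ?_
    rw [Finset.mem_Ico] at hk
    rw [if_neg (by push Not; intro hk'; exfalso; omega)]
  -- the set of lows and its maximal price
  set Lows := (Finset.range (j + 1)).filter (fun l : ℕ => 2 * ((l : ℕ) : ℝ) < T) with hLows
  have hLHS : ∑ l ∈ Finset.range (j + 1), (if 2 * (l : ℝ) < T then α l * μ l else 0) = ∑ l ∈ Lows, α l * μ l := by
    rw [hLows, Finset.sum_filter]
  rw [hLHS]
  by_cases hne : Lows.Nonempty
  swap
  · rw [Finset.not_nonempty_iff_eq_empty] at hne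
    rw [hne, Finset.sum_empty]
    refine le_trans ?_ hRHS
    exact add_nonneg (mul_nonneg (hβ h) (hμ0 h)) (Finset.sum_nonneg fun k _ => mul_nonneg (hβ k) (hμ0 k))
  obtain ⟨ls, hls, hmax⟩ := Finset.exists_max_image Lows α hne
  have hls' : ls ≤ j ∧ 2 * (ls : ℝ) < T := by
    rw [hLows, Finset.mem_filter, Finset.mem_range] at hls
    exact ⟨by omega, hls.2⟩
  set A := α ls with hA
  -- every giant is priced at least `A/u`
  have hgiant : ∀ k ∈ Finset.Ico (j + 1) (M + 1), A ≤ x / (1 - x) * β k := by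
    intro k hk
    rw [Finset.mem_Ico] at hk
    have := hαβ ls k hls'.1 hls'.2 (by omega) (Or.inl (by omega))
    rwa [usage_giant_eq x T j ls k (by omega)] at this
  have hgiantSum : A / (x / (1 - x)) * G ≤ ∑ k ∈ Finset.Ico (j + 1) (M + 1), β k * μ k := by
    rw [hG, Finset.mul_sum]
    refine Finset.sum_le_sum fun k hk => ?_
    have hk' := hgiant k hk
    have : A / (x / (1 - x)) ≤ β k := by rw [div_le_iff₀ hu0]; linarith
    exact mul_le_mul_of_nonneg_right this (hμ0 k)
  by_cases hA0 : A ≤ 0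
  · -- all low prices are nonpositive
    refine le_trans ?_ hRHS
    refine le_trans (Finset.sum_nonpos fun l hl => ?_) ?_
    · exact mul_nonpos_of_nonpos_of_nonneg ((hmax l hl).trans hA0) (hμ0 l)
    · exact add_nonneg (mul_nonneg (hβ h) (hμ0 h)) (Finset.sum_nonneg fun k _ => mul_nonneg (hβ k) (hμ0 k))
  push Not at hA0
  set y := β h with hy
  have hy0 : 0 ≤ y := hβ h
  -- compatible lows are priced at most `y · usage`
  have hcompat : ∀ l ∈ Lows, T < (l : ℝ) + h → α l ≤ usage x T j l h * y := by
    intro l hl hc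
    rw [hLows, Finset.mem_filter, Finset.mem_range] at hl
    exact hαβ l h (by omega) hl.2 hhM (Or.inr hc)
  rcases hy0.eq_or_lt with hy00 | hypos
  · -- `y = 0`: compatible lows are priced ≤ 0, incompatible ones ≤ A; use `u·L_inc ≤ G`
    have hterm : ∀ l ∈ Lows, α l * μ l ≤ A * (if 2 * (l : ℝ) < T ∧ ¬ (T < (l : ℝ) + h) then μ l else 0) := by
      intro l hl
      have hl2 : 2 * (l : ℝ) < T := by
        rw [hLows, Finset.mem_filter] at hl; exact hl.2
      by_cases hc : T < (l : ℝ) + h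
      · rw [if_neg (by push Not; intro _; exact hc)]
        have : α l ≤ 0 := by have := hcompat l hl hc; rw [← hy00, mul_zero] at this; exact this
        rw [mul_zero]; exact mul_nonpos_of_nonpos_of_nonneg this (hμ0 l)
      · rw [if_pos ⟨hl2, hc⟩]
        exact mul_le_mul_of_nonneg_right (hmax l hl) (hμ0 l)
    refine le_trans (Finset.sum_le_sum hterm) ?_
    rw [← Finset.mul_sum]
    have hinc' : ∑ l ∈ Lows, (if 2 * (l : ℝ) < T ∧ ¬ (T < (l : ℝ) + h) then μ l else 0)
        = ∑ l ∈ Finset.range (j + 1), (if 2 * (l : ℝ) < T ∧ ¬ (T < (l : ℝ) + h) then μ l else 0) := by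
      rw [hLows, Finset.sum_filter]
      refine Finset.sum_congr rfl fun l _ => ?_
      by_cases h2 : 2 * (l : ℝ) < T
      · rw [if_pos h2]
      · rw [if_neg h2, if_neg (by push Not; intro h; exact absurd h h2)]
    rw [hinc']
    refine le_trans ?_ hRHS
    have step : A * ∑ l ∈ Finset.range (j + 1), (if 2 * (l : ℝ) < T ∧ ¬ (T < (l : ℝ) + h) then μ l else 0) ≤ A / (x / (1 - x)) * G := by
      set S := ∑ l ∈ Finset.range (j + 1), (if 2 * (l : ℝ) < T ∧ ¬ (T < (l : ℝ) + h) then μ l else 0) with hS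
      have hune : x / (1 - x) ≠ 0 := hu0.ne'
      calc A * S = A / (x / (1 - x)) * ((x / (1 - x)) * S) := by field_simp
        _ ≤ A / (x / (1 - x)) * G := mul_le_mul_of_nonneg_left hinc (div_nonneg hA0.le hu0.le)
    refine le_trans step ?_
    refine le_trans hgiantSum ?_
    linarith [mul_nonneg (hβ h) (hμ0 h)]
  · -- `y > 0`: threshold `θ = A / y`
    set θ := A / y with hθ
    have hθ0 : 0 ≤ θ := div_nonneg hA0.le hypos.le
    have hAy : A = y * θ := by rw [hθ]; field_simp
    have hterm : ∀ l ∈ Lows, α l * μ l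
        ≤ y * (if 2 * (l : ℝ) < T then (if T < (l : ℝ) + h then μ l * min (usage x T j l h) θ else θ * μ l) else 0) := by
      intro l hl
      have hl2 : 2 * (l : ℝ) < T := by
        rw [hLows, Finset.mem_filter] at hl; exact hl.2
      rw [if_pos hl2]
      have hαA : α l ≤ A := hmax l hl
      by_cases hc : T < (l : ℝ) + h
      · rw [if_pos hc]
        have h1 : α l ≤ y * usage x T j l h := by rw [mul_comm]; exact hcompat l hl hc
        have h2 : α l ≤ y * θ := hAy ▸ hαA
        have : α l ≤ y * min (usage x T j l h) θ := by
          rw [mul_min_of_nonneg _ _ hypos.le]; exact le_min h1 h2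
        calc α l * μ l ≤ (y * min (usage x T j l h) θ) * μ l := mul_le_mul_of_nonneg_right this (hμ0 l)
          _ = y * (μ l * min (usage x T j l h) θ) := by ring
      · rw [if_neg hc]
        calc α l * μ l ≤ (y * θ) * μ l := mul_le_mul_of_nonneg_right (hAy ▸ hαA) (hμ0 l)
          _ = y * (θ * μ l) := by ring
    refine le_trans (Finset.sum_le_sum hterm) ?_
    rw [← Finset.mul_sum]
    have hsum' : ∑ l ∈ Lows, (if 2 * (l : ℝ) < T then (if T < (l : ℝ) + h then μ l * min (usage x T j l h) θ else θ * μ l) else 0)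
        = ∑ l ∈ Finset.range (j + 1),
            (if 2 * (l : ℝ) < T then (if T < (l : ℝ) + h then μ l * min (usage x T j l h) θ else θ * μ l) else 0) := by
      rw [hLows, Finset.sum_filter]
      refine Finset.sum_congr rfl fun l _ => ?_
      by_cases h2 : 2 * (l : ℝ) < T
      · rw [if_pos h2]
      · rw [if_neg h2, if_neg h2]
    rw [hsum']
    refine le_trans (mul_le_mul_of_nonneg_left (hknap θ hθ0) hypos.le) ?_
    refine le_trans ?_ hRHS
    have e : y * (μ h + θ * ((1 - x) / x) * G) = β h * μ h + A / (x / (1 - x)) * G := by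
      rw [hAy, hy]
      field_simp
    rw [e]
    linarith [hgiantSum]

/-- **THE SINGLE-MID CRITERION without incompatible lows**: if every low is compatible with the mid `h` (`T < l + h` for all lows `l` carrying
mass) the hypothesis is `Σ_l μ l · min(usage(l,h), θ) ≤ μ h + θ·G/u` for all `θ ≥ 0`. [this work] -/
theorem decAtT_of_singleMid_noInc (x T : ℝ) (j M h : ℕ) (μ : ℕ → ℝ) (hx0 : 0 < x) (hx1 : x < 1)
    (hμ0 : ∀ k, 0 ≤ μ k) (hμM : ∀ k, M < k → μ k = 0) (hμ1 : ∑ k ∈ Finset.range (M + 1), μ k = 1)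
    (hhj : h ≤ j) (hhM : h ≤ M) (hhT : T ≤ 2 * (h : ℝ))
    (hall : ∀ l, l ≤ j → 2 * (l : ℝ) < T → μ l ≠ 0 → T < (l : ℝ) + h)
    (hknap : ∀ θ : ℝ, 0 ≤ θ →
      ∑ l ∈ Finset.range (j + 1), (if 2 * (l : ℝ) < T then μ l * min (usage x T j l h) θ else 0)
        ≤ μ h + θ * ((1 - x) / x) * ∑ k ∈ Finset.Ico (j + 1) (M + 1), μ k) :
    DECAtT x T j M μ := by
  classical
  have hzero : ∀ l ∈ Finset.range (j + 1), (if 2 * (l : ℝ) < T ∧ ¬ (T < (l : ℝ) + h) then μ l else 0) = 0 := by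
    intro l hl
    rw [Finset.mem_range] at hl
    split_ifs with hc
    · by_contra hne
      exact hc.2 (hall l (by omega) hc.1 hne)
    · rfl
  refine decAtT_of_singleMid x T j M h μ hx0 hx1 hμ0 hμM hμ1 hhj hhM hhT ?_ fun θ hθ => ?_
  · rw [Finset.sum_congr rfl hzero, Finset.sum_const_zero, mul_zero]
    exact Finset.sum_nonneg fun k _ => hμ0 k
  · refine le_trans (le_of_eq (Finset.sum_congr rfl fun l hl => ?_)) (hknap θ hθ)
    rw [Finset.mem_range] at hl
    by_cases h2 : 2 * (l : ℝ) < T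
    · rw [if_pos h2, if_pos h2]
      by_cases hc : T < (l : ℝ) + h
      · rw [if_pos hc]
      · rw [if_neg hc]
        have : μ l = 0 := by
          by_contra hne; exact hc (hall l (by omega) h2 hne)
        rw [this]; ring
    · rw [if_neg h2, if_neg h2]

end LawDec

end Quant

end Summit.CriticalPhenomena.PercolationContinuityZ3.Theorems
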